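import Mathlib.Analysis.Real.Pi.Bounds
import Literature.Analysis.Fourier.ErdosTuranDiscrepancy
import Literature.NumberTheory.EllipticCurves.MurtySinhaKestenMcKay
import Literature.NumberTheory.EllipticCurves.MurtySinhaMultiplicityOfTraceFormula
import Literature.NumberTheory.EllipticCurves.MurtySinhaEquidistribution
import Literature.NumberTheory.EllipticCurves.DeligneHeckeEigenvalueBound
import HarnessLib

/-!
# Murty–Sinha's effective equidistribution theorem (Thm. 2, weight `2`) from the Eichler–Selberg
# trace formula and Deligne's bound (assembly)

Sibling file of `Literature.NumberTheory.EllipticCurves.MurtySinhaEquidistribution`, which vendors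
M. R. Murty, K. Sinha, *Effective equidistribution of eigenvalues of Hecke operators*, J. Number
Theory **129** (2009) 681–714 [MurtySinha2009], **Theorem 2** (p. 682) in weight `2` as the named
fact `murtySinha2009_thm2_weightTwo`:
`|#{i : a_{p,i} ∈ [α, β]} - s ∫_α^β dμ_p| ≤ A s log p / log 2N` (`s = dim S₂(Γ₀(N))`, `p ∤ N`).
It proves that fact **from the two external inputs of the printed proof**:

* the Eichler–Selberg trace formula — the tree's named fact
  `Literature.NumberTheory.Automorphic.HeckeTraceFormulaGL2Level N 1 2` (Schoof–van der Vlugt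
  Thm. 2.2 = Murty–Sinha Thm. 10), in fact only its instances `n = p^c` at the level `N` at hand;
* Deligne's bound `|a_{p,i}| ≤ 2√p` — the tree's named fact
  `Deligne1974_heckeT_eigenvalue_norm_le` (loc. cit. §1, p. 681: "By a result of Deligne [7], we
  know that the eigenvalues of `T_p` lie in the interval `[-2p^{(k-1)/2}, 2p^{(k-1)/2}]`"), in fact
  only its weight-`2` case; it is what places the normalised eigenvalues on `[-2, 2] = 2cos[0, π]`;

namely `murtySinha2009_thm2_weightTwo_of_traceFormula :
(∀ N, HeckeTraceFormulaGL2Level N 1 2) → Deligne1974_heckeT_eigenvalue_norm_le →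
murtySinha2009_thm2_weightTwo` and the sharper `murtySinha2009_thm2_weightTwo_of_primePowTraces`.
Everything else in the printed proof (pp. 684–701) is PROVED in the tree:

1. **Thm. 8** (Erdős–Turán for the `μ`-discrepancy, §§2–4): `Literature.Analysis.Fourier.
   abs_ceilCount_sub_integral_le` (Fejér-kernel proof; constants differ, immaterial);
2. **§§7–9, Thm. 13, Thm. 18** (the trace formula's spectral side, the estimates of the geometric
   side, the Weyl limits of Serre's measure): `MurtySinha.heckeT_gamma0_spectralData`
   (`MurtySinhaMultiplicityHeckeProofs`), the bounds of `MurtySinhaMultiplicityGeometricProofs`,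
   and the Fourier coefficients of `kmDensity` (`MurtySinhaKestenMcKay`);
3. **§10, Thm. 19** (insert Thm. 18 into Thm. 8 for the angles `±θ_i`, then `M = [c log kN/log p]`):
   this file — `MurtySinha.abs_card_Icc_sub_integral_le` (Thm. 19 in angle form, for any family of
   points of `[-2, 2]` with controlled Chebyshev moments), `MurtySinha.count_sub_integral_le_of_
   primePowTraces` (Thm. 19 for `T_p` on `S₂(Γ₀(N))`: `|count - s∫_α^β dμ_p| ≤ 288 s/(M+1) +
   44172 (M+1) p^{12M} (B(N)+1)`, with the crude moment errors of the multiplicity files in place of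
   (11)), and `MurtySinha.real_bookkeeping` (the choice of `M`, verbatim the bookkeeping of
   `multiplicity_bookkeeping` for a real quantity `≤ s`; levels below an explicit threshold are
   absorbed by the trivial bound `|count - s∫| ≤ 2s`).

The count of the vendored statement (a `finsum` over `μ : ℝ` of algebraic multiplicities
`dim maxGenEigenspace(T_p, μ)`) is identified with `#{i : x_i ∈ [α/√p, β/√p]}` for the eigenvalue
family `x_i = a_{p,i}/√p` through `maxGenEigenspace = eigenspace` (self-adjointness,
`maxGenEigenspace_eq_eigenspace_of_selfAdjoint` with the Petersson facts, as in
`heckeT_gamma0_spectralData`) and the realness of the spectrum; the integral through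
`MurtySinha.integral_serreDensity_eq` (`t = 2√p cos θ`).

## References

* [MurtySinha2009] Thm. 2 (p. 682), §1 (p. 681, Deligne), p. 684 (ingredients), Thm. 8 (p. 686),
  §§7–10 (pp. 691–701), Thm. 18 (p. 698), Thm. 19 (p. 701). Held:
  `paper:doi-10-1016-j-jnt-2008-10-010`.
* [SchoofVandervlugt1991] Thm. 2.2 (the trace formula); [Deligne1974] Thm. 8.2.
-/

noncomputable section

open scoped MatrixGroups ModularForm ComplexConjugate

open Real MeasureTheory intervalIntegral Finset
open CongruenceSubgroup
open Literature.Analysis.Fourier (abs_ceilCount_sub_integral_le)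

namespace Literature.NumberTheory.EllipticCurves.ModularForms

namespace MurtySinha

open Literature.NumberTheory.Automorphic
open Literature.NumberTheory.Automorphic.HeckeTraceFormulaGL2Level

section IntervalCount

variable {ι : Type*} [Fintype ι]

/-- `2 ∫_{-π}^{π} g_p(θ) cos((n+2)θ) dθ = γ_{n+2} - γ_n`, `γ_c = p^{-c/2}` for even `c` and `0` for
odd `c` — the Weyl limits `c_m = γ_m - γ_{m-2}` of Thm. 18 as differences of the Chebyshev moments
`γ_c = ∫ X_c dμ_p` (§9: `Σ_i X_m(a_{p,i}/√p) = p^{-m/2} Tr T_{p^m}`). [cite: MurtySinha2009, Thm.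
18 p. 698] -/
theorem two_mul_integral_kmDensity_mul_cos {p : ℝ} (hp : 1 < p) (n : ℕ) :
    2 * ∫ θ in (-π)..π, kmDensity p θ * Real.cos ((n + 2 : ℕ) * θ) =
      (if Even (n + 2) then (Real.sqrt p)⁻¹ ^ (n + 2) else 0) -
        (if Even n then (Real.sqrt p)⁻¹ ^ n else 0) := by
  have hp0 : 0 ≤ p := by linarith
  rcases Nat.even_or_odd n with ⟨b, rfl⟩ | ⟨b, rfl⟩
  · -- even `n = 2b`, `d = 2(b+1)`
    have h := integral_kmDensity_mul_cos_even hp (a := b + 1) (by omega)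
    rw [show ((b + b + 2 : ℕ) : ℝ) = 2 * ((b + 1 : ℕ) : ℝ) by push_cast; ring, h, Nat.add_sub_cancel]
    have e1 : (if Even (b + b + 2) then (Real.sqrt p)⁻¹ ^ (b + b + 2) else 0) = p⁻¹ ^ (b + 1) := by
      rw [if_pos ⟨b + 1, by ring⟩, show b + b + 2 = 2 * (b + 1) by ring, pow_mul, inv_pow,
        Real.sq_sqrt hp0, inv_pow]
    have e2 : (if Even (b + b) then (Real.sqrt p)⁻¹ ^ (b + b) else 0) = p⁻¹ ^ b := by
      rw [if_pos ⟨b, rfl⟩, show b + b = 2 * b by ring, pow_mul, inv_pow, Real.sq_sqrt hp0, inv_pow]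
    rw [e1, e2]
    ring
  · -- odd `n = 2b+1`, `d = 2(b+1)+1`
    have h := integral_kmDensity_mul_cos_odd hp (b + 1)
    rw [show ((2 * b + 1 + 2 : ℕ) : ℝ) = 2 * ((b + 1 : ℕ) : ℝ) + 1 by push_cast; ring, h]
    have e1 : (if Even (2 * b + 1 + 2) then (Real.sqrt p)⁻¹ ^ (2 * b + 1 + 2) else 0) = 0 := by
      rw [if_neg]; rw [Nat.not_even_iff_odd]; exact ⟨b + 1, by ring⟩
    have e2 : (if Even (2 * b + 1) then (Real.sqrt p)⁻¹ ^ (2 * b + 1) else 0) = 0 := by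
      rw [if_neg]; rw [Nat.not_even_iff_odd]; exact ⟨b, rfl⟩
    rw [e1, e2]
    ring

/-- `∫_{-π}^{π} g_p(θ) cos θ dθ = 0` (`c_1 = 0`). [cite: MurtySinha2009, Thm. 18 p. 698] -/
theorem integral_kmDensity_mul_cos_one {p : ℝ} (hp : 1 < p) :
    ∫ θ in (-π)..π, kmDensity p θ * Real.cos (1 * θ) = 0 := by
  have h := integral_kmDensity_mul_cos_odd hp 0
  simpa using h

/-- **Weyl sums of the symmetrised angles, cosine part** (Murty–Sinha §8–§9, p. 697–698: `Σ_i 2cos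
mθ_i = Tr T'_{p^m} - Tr T'_{p^{m-2}}` against `c_m r`): if `cos θ_i = x_i/2` and the Chebyshev
moments satisfy `|Σ_i X_c(x_i) - r γ_c| ≤ E` (`c ≤ M`; `X_c = U_c(·/2)`, `γ_c = p^{-c/2}` for even
`c`, `0` for odd `c`), then for `1 ≤ d ≤ M` the Weyl sum `Σ_i cos(dθ_i) + Σ_i cos(-dθ_i)` differs
from `2r ∫ g_p cos(d·)` by at most `2E`. [cite: MurtySinha2009, Thm. 18 p. 698] -/
theorem abs_weyl_cos_le (x θ : ι → ℝ) (hcos : ∀ i, Real.cos (θ i) = x i / 2) {p : ℝ} (hp : 1 < p)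
    {M : ℕ} {E : ℝ} (hE : 0 ≤ E)
    (hmom : ∀ c : ℕ, c ≤ M →
      |∑ i, (Polynomial.Chebyshev.U ℝ c).eval (x i / 2) -
        Fintype.card ι * (if Even c then (Real.sqrt p)⁻¹ ^ c else 0)| ≤ E)
    {d : ℕ} (hd1 : 1 ≤ d) (hdM : d ≤ M) :
    |(∑ i, Real.cos (d * θ i) + ∑ i, Real.cos (d * -θ i)) -
        (2 * Fintype.card ι) * ∫ t in (-π)..π, kmDensity p t * Real.cos (d * t)| ≤ 2 * E := by
  have hsym : ∑ i, Real.cos (d * -θ i) = ∑ i, Real.cos (d * θ i) :=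
    Finset.sum_congr rfl fun i _ => by rw [mul_neg, Real.cos_neg]
  rw [hsym, ← two_mul, Finset.mul_sum]
  rcases Nat.exists_eq_add_of_le hd1 with ⟨n, rfl⟩
  rcases n with _ | n
  · -- `d = 1`
    have h1 := hmom 1 hdM
    simp only [Nat.cast_one, add_zero] at *
    rw [integral_kmDensity_mul_cos_one hp, mul_zero, sub_zero]
    have e : ∀ i, 2 * Real.cos (1 * θ i) = (Polynomial.Chebyshev.U ℝ (1 : ℕ)).eval (x i / 2) := by
      intro i; rw [one_mul, two_mul_cos_eq_U_one, hcos]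
    simp_rw [e]
    rw [if_neg (by decide), mul_zero, sub_zero] at h1
    linarith [abs_nonneg (∑ i, (Polynomial.Chebyshev.U ℝ 1).eval (x i / 2))]
  · -- `d = n + 2`
    rw [show 1 + (n + 1) = n + 2 by ring] at hdM ⊢
    have e : ∀ i, 2 * Real.cos ((n + 2 : ℕ) * θ i) =
        (Polynomial.Chebyshev.U ℝ (n + 2 : ℕ)).eval (x i / 2) -
          (Polynomial.Chebyshev.U ℝ n).eval (x i / 2) := by
      intro i; rw [two_mul_cos_add_two_mul, hcos]
    simp_rw [e]
    rw [Finset.sum_sub_distrib, show (2 : ℝ) * Fintype.card ι * _ = Fintype.card ι *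
      (2 * ∫ t in (-π)..π, kmDensity p t * Real.cos ((n + 2 : ℕ) * t)) by ring,
      two_mul_integral_kmDensity_mul_cos hp n]
    have h1 := hmom (n + 2) hdM
    have h2 := hmom n (by omega)
    calc _ = |(∑ i, (Polynomial.Chebyshev.U ℝ (n + 2 : ℕ)).eval (x i / 2) -
          Fintype.card ι * (if Even (n + 2) then (Real.sqrt p)⁻¹ ^ (n + 2) else 0)) -
          (∑ i, (Polynomial.Chebyshev.U ℝ n).eval (x i / 2) -
            Fintype.card ι * (if Even n then (Real.sqrt p)⁻¹ ^ n else 0))| := by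
          congr 1; push_cast; ring
      _ ≤ _ := abs_sub _ _
      _ ≤ E + E := add_le_add h1 h2
      _ = 2 * E := by ring

/-- Weyl sums of the symmetrised angles, sine part: `Σ_i sin(dθ_i) + Σ_i sin(-dθ_i) = 0 = ∫ g_p
sin(d·)`. [folklore] -/
theorem abs_weyl_sin_le (θ : ι → ℝ) (p : ℝ) (d : ℕ) {E : ℝ} (hE : 0 ≤ E) :
    |(∑ i, Real.sin (d * θ i) + ∑ i, Real.sin (d * -θ i)) -
        (2 * Fintype.card ι) * ∫ t in (-π)..π, kmDensity p t * Real.sin (d * t)| ≤ 2 * E := by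
  have hsym : ∑ i, Real.sin (d * -θ i) = -∑ i, Real.sin (d * θ i) := by
    rw [← Finset.sum_neg_distrib]
    exact Finset.sum_congr rfl fun i _ => by rw [mul_neg, Real.sin_neg]
  rw [hsym, integral_kmDensity_mul_sin]
  simp only [add_neg_cancel, mul_zero, sub_zero, abs_zero]
  positivity

/-- **Interval counts from Chebyshev moments (Murty–Sinha Thm. 19 in angle form, Thm. 8
inserted).** Let `x_i ∈ [-2, 2]` (`i ∈ ι`, `r = #ι`), `p ≥ 2`, `E ≥ 0`, and suppose `|Σ_i X_c(x_i)
- r γ_c| ≤ E` for all `c ≤ M` (`X_c = U_c(·/2)`, `γ_c = p^{-c/2}` for even `c`, `0` for odd `c`).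
Then for `-2 ≤ a ≤ b ≤ 2`, `|#{i : x_i ∈ [a, b]} - r ∫_{arccos(b/2)}^{arccos(a/2)} 2g_p(θ) dθ| ≤
288 r/(M+1) + 3(M+1)E`: the Erdős–Turán inequality
`Literature.Analysis.Fourier.abs_ceilCount_sub_integral_le` for the `2r` points `±arccos(x_i/2)`
against `g_p` (`g_p ≤ 6/π`, Weyl sums by `abs_weyl_cos_le`), applied to the `δ`-enlarged and
`δ`-shrunken arcs of `two_mul_card_le_arcCount` / `arcCount_le_two_mul_card`, and `δ → 0`. Loc.
cit. Thm. 19 (p. 701) has `r/(M+1)` plus the trace-formula errors; the constant `288 = 24π·2·(6/π)`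
comes from the Fejér-kernel proof of Thm. 8. [cite: MurtySinha2009, Thm. 19 p. 701 (variant)] -/
theorem abs_card_Icc_sub_integral_le (x : ι → ℝ) (hx : ∀ i, |x i| ≤ 2) {p : ℝ} (hp : 2 ≤ p)
    {M : ℕ} {E : ℝ} (hE : 0 ≤ E)
    (hmom : ∀ c : ℕ, c ≤ M →
      |∑ i, (Polynomial.Chebyshev.U ℝ c).eval (x i / 2) -
        Fintype.card ι * (if Even c then (Real.sqrt p)⁻¹ ^ c else 0)| ≤ E)
    {a b : ℝ} (ha : -2 ≤ a) (hab : a ≤ b) (hb : b ≤ 2) :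
    |((Finset.univ.filter fun i => x i ∈ Set.Icc a b).card : ℝ) -
        Fintype.card ι * ∫ θ in Real.arccos (b / 2)..Real.arccos (a / 2), 2 * kmDensity p θ|
      ≤ 288 * Fintype.card ι / (M + 1) + 3 * (M + 1) * E := by
  classical
  have hp1 : 1 < p := by linarith
  have hπ := Real.pi_pos
  -- the angles
  set θ : ι → ℝ := fun i => Real.arccos (x i / 2) with hθ
  have hθmem : ∀ i, θ i ∈ Set.Icc 0 π := fun i => ⟨Real.arccos_nonneg _, Real.arccos_le_pi _⟩
  have hx' : ∀ i, -1 ≤ x i / 2 ∧ x i / 2 ≤ 1 := fun i => by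
    have := abs_le.mp (hx i); constructor <;> linarith
  have hcos : ∀ i, Real.cos (θ i) = x i / 2 := fun i => Real.cos_arccos (hx' i).1 (hx' i).2
  set θa := Real.arccos (a / 2) with hθa
  set θb := Real.arccos (b / 2) with hθb
  have hθb0 : 0 ≤ θb := Real.arccos_nonneg _
  have hθaπ : θa ≤ π := Real.arccos_le_pi _
  have hθba : θb ≤ θa := Real.arccos_le_arccos (by linarith)
  -- `x_i ∈ [a, b] ↔ θ_i ∈ [θ_b, θ_a]`
  have hmemI : ∀ i, x i ∈ Set.Icc a b ↔ θ i ∈ Set.Icc θb θa := by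
    intro i
    have ha' : a / 2 ∈ Set.Icc (-1 : ℝ) 1 := ⟨by linarith, by linarith⟩
    have hb' : b / 2 ∈ Set.Icc (-1 : ℝ) 1 := ⟨by linarith, by linarith⟩
    have hxi : x i / 2 ∈ Set.Icc (-1 : ℝ) 1 := ⟨(hx' i).1, (hx' i).2⟩
    rw [Set.mem_Icc, Set.mem_Icc, hθ, hθa, hθb]
    simp only
    rw [StrictAntiOn.le_iff_ge Real.strictAntiOn_arccos hb' hxi,
      StrictAntiOn.le_iff_ge Real.strictAntiOn_arccos hxi ha']
    constructor <;> rintro ⟨h1, h2⟩ <;> constructor <;> linarith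
  have hcardI : (Finset.univ.filter fun i => x i ∈ Set.Icc a b) =
      Finset.univ.filter fun i => θ i ∈ Set.Icc θb θa :=
    Finset.filter_congr fun i _ => hmemI i
  rw [hcardI]
  set N : ℝ := ((Finset.univ.filter fun i => θ i ∈ Set.Icc θb θa).card : ℝ) with hN
  -- the Erdős–Turán bound for the points `±θ_i`
  set P : ι ⊕ ι → ℝ := Sum.elim θ (fun i => -θ i) with hP
  set r : ℝ := (Fintype.card ι : ℝ) with hr
  have hn : (Fintype.card (ι ⊕ ι) : ℝ) = 2 * r := by
    rw [Fintype.card_sum, hr]; push_cast; ring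
  have hg := continuous_kmDensity hp1
  have hGle : ∀ t, kmDensity p t ≤ 6 / π := kmDensity_le_six_div_pi hp
  have hF : ∀ d : ℕ, 1 ≤ d → d ≤ M →
      |∑ j, Real.cos (d * P j) - Fintype.card (ι ⊕ ι) *
          ∫ t in (-π)..π, kmDensity p t * Real.cos (d * t)| ≤ 2 * E ∧
      |∑ j, Real.sin (d * P j) - Fintype.card (ι ⊕ ι) *
          ∫ t in (-π)..π, kmDensity p t * Real.sin (d * t)| ≤ 2 * E := by
    intro d hd1 hdM
    rw [hn, Fintype.sum_sum_type, Fintype.sum_sum_type]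
    simp only [hP, Sum.elim_inl, Sum.elim_inr]
    exact ⟨abs_weyl_cos_le x θ hcos hp1 hE hmom hd1 hdM, abs_weyl_sin_le θ p d hE⟩
  set Bnd : ℝ := 24 * π * (2 * r * (6 / π)) / (M + 1) + 4 * (M + 1) * (2 * E) / π with hBnd
  have ET : ∀ u v : ℝ, |∑ j, arcCount u v (P j) - 2 * r * ∫ t in u..v, kmDensity p t| ≤ Bnd := by
    intro u v
    have h := abs_ceilCount_sub_integral_le P hg (kmDensity_periodic p) (integral_kmDensity hp1)
      (by positivity : (0 : ℝ) ≤ 6 / π) hGle (by positivity : (0 : ℝ) ≤ 2 * E) hF u v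
    rw [hn] at h
    convert h using 3
    simp only [arcCount]
  have hBnd_le : Bnd ≤ 288 * r / (M + 1) + 3 * (M + 1) * E := by
    rw [hBnd]
    have hM : (0 : ℝ) < M + 1 := by positivity
    have e1 : 24 * π * (2 * r * (6 / π)) / (M + 1) = 288 * r / (M + 1) := by
      field_simp; ring
    have e2 : 4 * (M + 1) * (2 * E) / π ≤ 3 * (M + 1) * E := by
      rw [div_le_iff₀ hπ]
      have : (8 : ℝ) ≤ 3 * π := by linarith [Real.pi_gt_three]
      nlinarith [mul_nonneg hM.le hE]
    linarith
  -- arc sums split over `ι ⊕ ι`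
  have hsplit : ∀ u v : ℝ, ∑ j, arcCount u v (P j) =
      ∑ i, (arcCount u v (θ i) + arcCount u v (-θ i)) := by
    intro u v
    rw [Fintype.sum_sum_type, ← Finset.sum_add_distrib]
    simp only [hP, Sum.elim_inl, Sum.elim_inr]
  -- pieces of integrals
  have hint : ∀ u v, IntervalIntegrable (kmDensity p) volume u v := fun u v => hg.intervalIntegrable u v
  have hsmall : ∀ u δ : ℝ, 0 ≤ δ → ∫ t in u..u + δ, kmDensity p t ≤ 6 / π * δ := by
    intro u δ hδ
    have h := intervalIntegral.integral_mono_on (by linarith) (hint u (u + δ))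
      (intervalIntegrable_const : IntervalIntegrable (fun _ => 6 / π) volume u (u + δ))
      (fun t _ => hGle t)
    rw [intervalIntegral.integral_const, smul_eq_mul] at h
    linarith [show (u + δ - u) * (6 / π) = 6 / π * δ by ring]
  have hsmall' : ∀ u δ : ℝ, 0 ≤ δ → 0 ≤ ∫ t in u..u + δ, kmDensity p t := fun u δ hδ =>
    intervalIntegral.integral_nonneg (by linarith) fun t _ => kmDensity_nonneg hp1 t
  have hrefl : ∫ t in (-θa)..(-θb), kmDensity p t = ∫ t in θb..θa, kmDensity p t := by
    rw [← intervalIntegral.integral_comp_neg]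
    simp_rw [kmDensity_neg]
  set I : ℝ := ∫ t in θb..θa, kmDensity p t with hI
  have hmain : ∀ δ : ℝ, 0 < δ → δ ≤ π → |N - 2 * r * I| ≤ Bnd + 2 * r * (6 / π) * δ := by
    intro δ hδ hδπ
    have hr0 : 0 ≤ r := by rw [hr]; positivity
    -- upper
    have hup := two_mul_card_le_arcCount θ hθmem hθb0 hθba hθaπ hδ hδπ
    have E1 := ET θb (θa + δ)
    have E2 := ET (-θa) (-θb + δ)
    rw [hsplit] at E1 E2
    have i1 : ∫ t in θb..(θa + δ), kmDensity p t = I + ∫ t in θa..(θa + δ), kmDensity p t :=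
      (intervalIntegral.integral_add_adjacent_intervals (hint _ _) (hint _ _)).symm
    have i2 : ∫ t in (-θa)..(-θb + δ), kmDensity p t = I + ∫ t in (-θb)..(-θb + δ), kmDensity p t := by
      rw [← intervalIntegral.integral_add_adjacent_intervals (hint (-θa) (-θb)) (hint _ _), hrefl]
    have s1 := hsmall θa δ hδ.le
    have s2 := hsmall (-θb) δ hδ.le
    -- lower
    have hlo := arcCount_le_two_mul_card θ hθmem hθb0 hθaπ hδ hδπ
    have E3 := ET (θb + δ) θa
    have E4 := ET (-θa + δ) (-θb)
    rw [hsplit] at E3 E4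
    have i3 : ∫ t in (θb + δ)..θa, kmDensity p t = I - ∫ t in θb..(θb + δ), kmDensity p t := by
      have h := intervalIntegral.integral_add_adjacent_intervals (hint θb (θb + δ))
        (hint (θb + δ) θa)
      rw [← hI] at h
      linarith
    have i4 : ∫ t in (-θa + δ)..(-θb), kmDensity p t =
        I - ∫ t in (-θa)..(-θa + δ), kmDensity p t := by
      have h := intervalIntegral.integral_add_adjacent_intervals (hint (-θa) (-θa + δ))
        (hint (-θa + δ) (-θb))
      rw [hrefl] at h
      linarith
    have s3 := hsmall θb δ hδ.le
    have s4 := hsmall (-θa) δ hδ.le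
    have s3' := hsmall' θb δ hδ.le
    have s4' := hsmall' (-θa) δ hδ.le
    have s1' := hsmall' θa δ hδ.le
    have s2' := hsmall' (-θb) δ hδ.le
    rw [i1] at E1
    rw [i2] at E2
    rw [i3] at E3
    rw [i4] at E4
    have h2r : (0 : ℝ) ≤ 2 * r := by positivity
    have m1 := mul_le_mul_of_nonneg_left s1 h2r
    have m2 := mul_le_mul_of_nonneg_left s2 h2r
    have m3 := mul_le_mul_of_nonneg_left s3 h2r
    have m4 := mul_le_mul_of_nonneg_left s4 h2r
    have m1' := mul_nonneg h2r s1'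
    have m2' := mul_nonneg h2r s2'
    have m3' := mul_nonneg h2r s3'
    have m4' := mul_nonneg h2r s4'
    have d1 : 2 * r * (I + ∫ t in θa..(θa + δ), kmDensity p t) =
        2 * r * I + 2 * r * ∫ t in θa..(θa + δ), kmDensity p t := by ring
    have d2 : 2 * r * (I + ∫ t in (-θb)..(-θb + δ), kmDensity p t) =
        2 * r * I + 2 * r * ∫ t in (-θb)..(-θb + δ), kmDensity p t := by ring
    have d3 : 2 * r * (I - ∫ t in θb..(θb + δ), kmDensity p t) =
        2 * r * I - 2 * r * ∫ t in θb..(θb + δ), kmDensity p t := by ring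
    have d4 : 2 * r * (I - ∫ t in (-θa)..(-θa + δ), kmDensity p t) =
        2 * r * I - 2 * r * ∫ t in (-θa)..(-θa + δ), kmDensity p t := by ring
    have d5 : 2 * r * (6 / π * δ) = 2 * r * (6 / π) * δ := by ring
    rw [d1] at E1
    rw [d2] at E2
    rw [d3] at E3
    rw [d4] at E4
    rw [d5] at m1 m2 m3 m4
    rw [abs_le] at E1 E2 E3 E4 ⊢
    rw [hN]
    constructor
    · linarith [E3.1, E4.1, hlo]
    · linarith [E1.2, E2.2, hup]
  -- let `δ → 0`
  have hfinal : |N - 2 * r * I| ≤ Bnd := by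
    refine le_of_forall_pos_le_add fun ε hε => ?_
    have hr0 : 0 ≤ r := by rw [hr]; positivity
    set K : ℝ := 2 * r * (6 / π) with hK
    have hK0 : 0 ≤ K := by positivity
    set δ : ℝ := min π (ε / (K + 1)) with hδ
    have hδ0 : 0 < δ := lt_min hπ (by positivity)
    have hδπ : δ ≤ π := min_le_left _ _
    have hδε : K * δ ≤ ε := by
      have h1 : δ ≤ ε / (K + 1) := min_le_right _ _
      have h2 : K * δ ≤ K * (ε / (K + 1)) := mul_le_mul_of_nonneg_left h1 hK0
      have h3 : K * (ε / (K + 1)) ≤ ε := by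
        rw [mul_div_assoc', div_le_iff₀ (by positivity)]; nlinarith
      linarith
    have := hmain δ hδ0 hδπ
    linarith
  have hI2 : r * ∫ t in θb..θa, 2 * kmDensity p t = 2 * r * I := by
    rw [intervalIntegral.integral_const_mul]; ring
  rw [hI2]
  exact hfinal.trans hBnd_le

end IntervalCount

/-- `0 ≤ ∫_u^v 2g_p ≤ 1` for `0 ≤ u ≤ v ≤ π` (`∫_0^π 2g_p = 1` by evenness). [folklore] -/
theorem integral_two_mul_kmDensity_mem {p : ℝ} (hp : 1 < p) {u v : ℝ} (hu : 0 ≤ u) (huv : u ≤ v)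
    (hv : v ≤ π) : (∫ θ in u..v, 2 * kmDensity p θ) ∈ Set.Icc (0 : ℝ) 1 := by
  have hg := continuous_kmDensity hp
  have hi : ∀ a b, IntervalIntegrable (fun θ => 2 * kmDensity p θ) volume a b := fun a b =>
    (hg.const_mul 2).intervalIntegrable a b
  have hnn : ∀ θ, 0 ≤ 2 * kmDensity p θ := fun θ => by linarith [kmDensity_nonneg hp θ]
  have hhalf : ∫ θ in (0 : ℝ)..π, 2 * kmDensity p θ = 1 := by
    have h1 := integral_kmDensity hp
    have h2 : ∫ θ in (-π)..0, kmDensity p θ = ∫ θ in (0 : ℝ)..π, kmDensity p θ := by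
      have h := intervalIntegral.integral_comp_neg (a := 0) (b := π) (fun θ => kmDensity p θ)
      simp only [neg_zero, kmDensity_neg] at h
      exact h.symm
    rw [← intervalIntegral.integral_add_adjacent_intervals (hg.intervalIntegrable (-π) 0)
      (hg.intervalIntegrable 0 π), h2] at h1
    rw [intervalIntegral.integral_const_mul]
    linarith
  constructor
  · exact intervalIntegral.integral_nonneg huv fun θ _ => hnn θ
  · rw [← hhalf]
    exact intervalIntegral.integral_mono_interval hu huv hv
      (Filter.Eventually.of_forall hnn) (hi 0 π)

/-- **Murty–Sinha Thm. 19 for `S₂(Γ₀(N))`, from the trace identities at the powers of `p` and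
Deligne's bound.** Let `p ∤ N` be prime, `r = dim S₂(Γ₀(N))`, `B(N) = Σ_{c ∣ N} gcd(c, N/c)`, `-2√p
≤ α ≤ β ≤ 2√p`. If `Tr(T_{p^c} | S₂(Γ₀(N))) = A₁ + A₂ + A₃ + A₄` (`cuspidalHeckeTrace N 2 1 (p^c) =
geometricSide N 1 2 (p^c)`) for all `c ≥ 0` and every eigenvalue `μ` of `T_p` on `S₂(Γ₀(N))` has
`|μ| ≤ 2√p` (Deligne; loc. cit. §1 p. 681), then for every `M ≥ 0` the number of eigenvalues of
`T_p` in `[α, β]` (algebraic multiplicities, as in the vendored statement) differs from `r ∫_α^β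
dμ_p` by at most `288 r/(M+1) + 44172 (M+1) p^{12M} (B(N)+1)`; moreover `|r - ψ(N)/12| ≤
7361(B(N)+1)` (Thm. 13), the count is `≤ r` and `0 ≤ ∫_α^β dμ_p ≤ 1`. Assembly:
`MurtySinha.heckeT_gamma0_spectralData` and the moment bounds of
`multiplicity_le_of_primePowTraces` (verbatim), Deligne for `|a_{p,i}/√p| ≤ 2`,
`abs_card_Icc_sub_integral_le`, and the change of variables `integral_serreDensity_eq`. [cite:
MurtySinha2009, Thm. 19 p. 701 and §10 pp. 699–701] -/
theorem count_sub_integral_le_of_primePowTraces (N : ℕ) [NeZero N] (p : ℕ) [NeZero p]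
    (hp : p.Prime) (hpN : ¬ p ∣ N)
    (hTF : ∀ c : ℕ, cuspidalHeckeTrace N 2 1 (p ^ c) = geometricSide N 1 2 (p ^ c))
    (hD : ∀ μ : ℂ, Module.End.HasEigenvalue (heckeT (Gamma0 N) 2 p) μ → ‖μ‖ ≤ 2 * Real.sqrt p)
    {α β : ℝ} (hα : -(2 * Real.sqrt p) ≤ α) (hαβ : α ≤ β) (hβ : β ≤ 2 * Real.sqrt p) (M : ℕ) :
    |(∑ᶠ μ : ℝ, (Set.Icc α β).indicator (fun μ =>
        (Module.finrank ℂ (Module.End.maxGenEigenspace (heckeT (Gamma0 N) 2 p) (μ : ℂ)) : ℝ)) μ) -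
        (Module.finrank ℂ (CuspForm (Gamma0 N) 2) : ℝ) * ∫ t in α..β, serreDensity p t|
      ≤ 288 * (Module.finrank ℂ (CuspForm (Gamma0 N) 2) : ℝ) / (M + 1) +
          44172 * (M + 1) * (p : ℝ) ^ (12 * M) * (∑ c ∈ N.divisors, (Nat.gcd c (N / c) : ℝ) + 1) ∧
      |(Module.finrank ℂ (CuspForm (Gamma0 N) 2) : ℝ) - (dedekindPsi N : ℝ) / 12| ≤
        7361 * (∑ c ∈ N.divisors, (Nat.gcd c (N / c) : ℝ) + 1) ∧
      (∑ᶠ μ : ℝ, (Set.Icc α β).indicator (fun μ =>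
        (Module.finrank ℂ (Module.End.maxGenEigenspace (heckeT (Gamma0 N) 2 p) (μ : ℂ)) : ℝ)) μ) ≤
        Module.finrank ℂ (CuspForm (Gamma0 N) 2) ∧
      (∫ t in α..β, serreDensity p t) ∈ Set.Icc (0 : ℝ) 1 := by
  classical
  haveI : FiniteDimensional ℂ (CuspForm (Gamma0 N) 2) := finiteDimensional_cuspForm_gamma0 N 2
  set T : Module.End ℂ (CuspForm (Gamma0 N) 2) := heckeT (Gamma0 N) 2 p with hT_def
  set r : ℕ := Module.finrank ℂ (CuspForm (Gamma0 N) 2) with hr_def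
  set B : ℝ := ∑ c ∈ N.divisors, (Nat.gcd c (N / c) : ℝ) with hB_def
  have hB : 0 ≤ B := Finset.sum_nonneg fun _ _ ↦ by positivity
  have hN0 : N ≠ 0 := NeZero.ne N
  have hp2 : (2 : ℝ) ≤ p := by exact_mod_cast hp.two_le
  have hp1 : (1 : ℝ) ≤ p := by linarith
  -- `s = √p`, `q = 1/s`
  set s : ℝ := Real.sqrt p with hs_def
  have hs0 : 0 < s := Real.sqrt_pos.mpr (by linarith)
  have hs1 : 1 < s := by
    rw [hs_def, Real.lt_sqrt zero_le_one]
    linarith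
  have hsne : s ≠ 0 := hs0.ne'
  have hss : s * s = p := Real.mul_self_sqrt (by linarith)
  have hs2 : s ^ 2 = p := by rw [sq, hss]
  set q : ℝ := s⁻¹ with hq_def
  have hq0 : 0 ≤ q := inv_nonneg.mpr hs0.le
  have hq1 : q < 1 := inv_lt_one_of_one_lt₀ hs1
  have hqle : q ≤ 1 := hq1.le
  have hqs : q * s = 1 := inv_mul_cancel₀ hs0.ne'
  -- spectral data
  obtain ⟨E, hreal, hbot, hdim, htr⟩ := heckeT_gamma0_spectralData N 2 p hp hpN
  set d : ℂ → ℕ := fun μ ↦ Module.finrank ℂ (Module.End.eigenspace T μ) with hd_def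
  set y : ℂ → ℝ := fun μ ↦ μ.re / s with hy_def
  -- the polynomials `Q_m(μ) = s^m X_m(μ.re/s)` satisfy the `T_{p^m}`-recursion on `E`
  set Q : ℕ → ℂ → ℂ := fun m μ ↦ ((s ^ m * chebX m (y μ) : ℝ) : ℂ) with hQ_def
  have hre : ∀ μ ∈ E, ((μ.re : ℝ) : ℂ) = μ := fun μ hμ ↦ Complex.conj_eq_iff_re.mp (hreal μ hμ)
  have hQ0 : ∀ μ ∈ E, Q 0 μ = 1 := fun μ _ ↦ by simp [hQ_def]
  have hQ1 : ∀ μ ∈ E, Q 1 μ = μ := fun μ hμ ↦ by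
    simp only [hQ_def, pow_one, chebX_one, hy_def]
    rw [mul_div_assoc', mul_div_cancel_left₀ _ hsne, hre μ hμ]
  have hQ2 : ∀ μ ∈ E, ∀ m : ℕ,
      Q (m + 2) μ = μ * Q (m + 1) μ - (p : ℂ) ^ ((2 : ℤ) - 1) * Q m μ := by
    intro μ hμ m
    have hz : (p : ℂ) ^ ((2 : ℤ) - 1) = p := by norm_num
    rw [hz]
    have key : s ^ (m + 2) * chebX (m + 2) (y μ) =
        μ.re * (s ^ (m + 1) * chebX (m + 1) (y μ)) - p * (s ^ m * chebX m (y μ)) := by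
      rw [chebX_add_two, ← hs2]
      simp only [hy_def]
      field_simp
      ring
    simp only [hQ_def]
    rw [key]
    push_cast
    rw [hre μ hμ]
  -- real moments `Sr c = Σ_μ d_μ X_c(y μ)` and the trace identity `Tr(T_{p^c}) = s^c Sr c`
  set Sr : ℕ → ℝ := fun c ↦ ∑ μ ∈ E, (d μ : ℝ) * chebX c (y μ) with hSr_def
  have htrace : ∀ c : ℕ, cuspidalHeckeTrace N 2 1 (p ^ c) = ((s ^ c * Sr c : ℝ) : ℂ) := by
    intro c
    rw [htr Q hQ0 hQ1 hQ2 c]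
    simp only [hSr_def, Finset.mul_sum]
    push_cast
    refine Finset.sum_congr rfl fun μ _ ↦ ?_
    simp only [hQ_def, hd_def]
    push_cast
    ring
  have hrsum : (r : ℝ) = ∑ μ ∈ E, (d μ : ℝ) := by
    have h : ((r : ℝ) : ℂ) = ((∑ μ ∈ E, (d μ : ℝ) : ℝ) : ℂ) := by
      push_cast
      exact_mod_cast hdim
    exact_mod_cast h
  have hSr0 : Sr 0 = r := by
    rw [hrsum, hSr_def]
    simp
  -- the trace formula: `s^c Sr c = A₁(p^c) + A₂ + A₃ + A₄`, with `A₁ = [c even] ψ/12`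
  have hgeo : ∀ c : ℕ, ((s ^ c * Sr c : ℝ) : ℂ) -
      (if Even c then ((dedekindPsi N : ℚ) : ℂ) / 12 else 0) =
      ellipticTerm N 1 2 (p ^ c) + hyperbolicTerm N 1 2 (p ^ c) + parabolicTerm N 1 2 (p ^ c) := by
    intro c
    rw [← htrace c, hTF c, ← identityTerm_one_two_prime_pow N p hp hpN c, geometricSide]
    ring
  -- the error `e(n) = 7360 n^6 B + n^2 B + n^2` of the three remaining terms
  have herr : ∀ c : ℕ, ‖ellipticTerm N 1 2 (p ^ c) + hyperbolicTerm N 1 2 (p ^ c) +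
      parabolicTerm N 1 2 (p ^ c)‖ ≤
      7360 * ((p : ℝ) ^ c) ^ 6 * B + ((p : ℝ) ^ c) ^ 2 * B + ((p : ℝ) ^ c) ^ 2 := by
    intro c
    have hn1 : 1 ≤ p ^ c := Nat.one_le_pow c p hp.pos
    have h1 := norm_ellipticTerm_one_two_le N (p ^ c) hn1
    have h2 := norm_hyperbolicTerm_one_two_le N (p ^ c)
    have h3 := norm_parabolicTerm_le N 1 2 (p ^ c)
    rw [← hB_def] at h1 h2
    push_cast at h1 h2 h3
    calc _ ≤ ‖ellipticTerm N 1 2 (p ^ c) + hyperbolicTerm N 1 2 (p ^ c)‖ +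
          ‖parabolicTerm N 1 2 (p ^ c)‖ := norm_add_le _ _
      _ ≤ ‖ellipticTerm N 1 2 (p ^ c)‖ + ‖hyperbolicTerm N 1 2 (p ^ c)‖ +
          ‖parabolicTerm N 1 2 (p ^ c)‖ := add_le_add (norm_add_le _ _) le_rfl
      _ ≤ _ := by linarith
  -- consequence 1 (Thm. 13): `|r - ψ/12| ≤ 7361 B + 1 ≤ 7361 (B + 1)`
  have hdimψ' : |(r : ℝ) - (dedekindPsi N : ℝ) / 12| ≤ 7361 * B + 1 := by
    have h := hgeo 0
    simp only [pow_zero, one_mul, Even.zero, if_true, hSr0] at h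
    have h' : (((r : ℝ) - (dedekindPsi N : ℝ) / 12 : ℝ) : ℂ) =
        ellipticTerm N 1 2 1 + hyperbolicTerm N 1 2 1 + parabolicTerm N 1 2 1 := by
      rw [← h]
      push_cast
      ring
    have hn := herr 0
    simp only [pow_zero, one_pow, mul_one, one_mul] at hn
    rw [← h', Complex.norm_real, Real.norm_eq_abs] at hn
    linarith
  have hdimψ : |(r : ℝ) - (dedekindPsi N : ℝ) / 12| ≤ 7361 * (B + 1) := by linarith [hdimψ']
  -- consequence 2: the moment bounds `|Sr c - r γ_c| ≤ E_M` for `c ≤ 2M`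
  set γ : ℕ → ℝ := fun c ↦ if Even c then q ^ c else 0 with hγ_def
  have hγ : ∀ c, |γ c| ≤ q ^ c := fun c ↦ by
    simp only [hγ_def]
    split_ifs
    · rw [abs_of_nonneg (pow_nonneg hq0 c)]
    · rw [abs_zero]
      exact pow_nonneg hq0 c
  set EM : ℝ := 14724 * (p : ℝ) ^ (12 * M) * (B + 1) with hEM_def
  have hmom : ∀ c ≤ 2 * M, |Sr c - r * γ c| ≤ EM := by
    intro c hc
    -- `|s^c Sr c - [c even] ψ/12| ≤ e(p^c)` and `|r - ψ/12| ≤ e(1)`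
    have hA : |s ^ c * Sr c - (if Even c then (dedekindPsi N : ℝ) / 12 else 0)| ≤
        7360 * ((p : ℝ) ^ c) ^ 6 * B + ((p : ℝ) ^ c) ^ 2 * B + ((p : ℝ) ^ c) ^ 2 := by
      have h := hgeo c
      have hcast : ((s ^ c * Sr c - (if Even c then (dedekindPsi N : ℝ) / 12 else 0) : ℝ) : ℂ) =
          ((s ^ c * Sr c : ℝ) : ℂ) - (if Even c then ((dedekindPsi N : ℚ) : ℂ) / 12 else 0) := by
        split_ifs <;> push_cast <;> ring
      have hn := herr c
      rw [← h, ← hcast, Complex.norm_real, Real.norm_eq_abs] at hn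
      exact hn
    have hR : |(r : ℝ) - (dedekindPsi N : ℝ) / 12| ≤ 7361 * B + 1 := hdimψ'
    -- combine: `Sr c - r γ_c = q^c ((s^c Sr c - [even] ψ/12) - [even] (r - ψ/12))`
    have hqc : q ^ c * s ^ c = 1 := by rw [← mul_pow, hqs, one_pow]
    have hqc1 : q ^ c ≤ 1 := pow_le_one₀ hq0 hqle
    have hqc0 : 0 ≤ q ^ c := pow_nonneg hq0 c
    have hkey : Sr c - r * γ c = q ^ c * ((s ^ c * Sr c -
        (if Even c then (dedekindPsi N : ℝ) / 12 else 0)) -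
        (if Even c then ((r : ℝ) - (dedekindPsi N : ℝ) / 12) else 0)) := by
      simp only [hγ_def]
      split_ifs <;> linear_combination (-(Sr c)) * hqc
    rw [hkey, abs_mul, abs_of_nonneg hqc0]
    have hsecond : |(if Even c then ((r : ℝ) - (dedekindPsi N : ℝ) / 12) else 0)| ≤ 7361 * B + 1 := by
      split_ifs
      · exact hR
      · rw [abs_zero]; positivity
    have hpc : ((p : ℝ) ^ c) ^ 6 ≤ (p : ℝ) ^ (12 * M) := by
      rw [← pow_mul]
      exact pow_le_pow_right₀ hp1 (by omega)
    have hpc2 : ((p : ℝ) ^ c) ^ 2 ≤ (p : ℝ) ^ (12 * M) := by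
      rw [← pow_mul]
      exact pow_le_pow_right₀ hp1 (by omega)
    have hpM1 : (1 : ℝ) ≤ (p : ℝ) ^ (12 * M) := one_le_pow₀ hp1
    calc q ^ c * |(s ^ c * Sr c - (if Even c then (dedekindPsi N : ℝ) / 12 else 0)) -
          (if Even c then ((r : ℝ) - (dedekindPsi N : ℝ) / 12) else 0)|
        ≤ 1 * ((7360 * ((p : ℝ) ^ c) ^ 6 * B + ((p : ℝ) ^ c) ^ 2 * B + ((p : ℝ) ^ c) ^ 2) +
            (7361 * B + 1)) := by
          refine mul_le_mul hqc1 ((abs_sub _ _).trans (add_le_add hA hsecond)) (abs_nonneg _)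
            zero_le_one
      _ ≤ EM := by
          rw [one_mul, hEM_def]
          nlinarith [mul_le_mul_of_nonneg_right hpc hB, mul_le_mul_of_nonneg_right hpc2 hB,
            mul_le_mul_of_nonneg_right hpM1 hB, hpM1, hpc2, hB]
  -- the eigenvalue family indexed by `ι = Σ_{μ ∈ E} Fin d_μ`
  have hrsumN : r = ∑ μ ∈ E, d μ := by exact_mod_cast hrsum
  let ι : Type := (μ : E) × Fin (d μ)
  set x : ι → ℝ := fun i ↦ y i.1 with hx_def
  have hcardι : Fintype.card ι = r := by
    rw [hrsumN, Fintype.card_sigma]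
    simp only [Fintype.card_fin]
    exact Finset.sum_coe_sort E d
  have hsumι : ∀ c : ℕ, ∑ i : ι, chebX c (x i) = Sr c := by
    intro c
    show ∑ i : ι, chebX c (x i) = ∑ μ ∈ E, (d μ : ℝ) * chebX c (y μ)
    rw [← Finset.sum_coe_sort E (fun μ ↦ (d μ : ℝ) * chebX c (y μ)),
      ← Finset.univ_sigma_univ, Finset.sum_sigma]
    refine Finset.sum_congr rfl fun μ _ ↦ ?_
    simp [hx_def, Finset.sum_const, Finset.card_univ, Fintype.card_fin, nsmul_eq_mul]
  -- (1) Deligne: the normalised eigenvalues lie in `[-2, 2]`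
  have hx2 : ∀ i : ι, |x i| ≤ 2 := by
    rintro ⟨⟨μ, hμE⟩, j⟩
    have hdpos : 0 < d μ := Fin.pos j
    have hne : Module.End.eigenspace T μ ≠ ⊥ := by
      intro h
      simp only [hd_def] at hdpos
      rw [h, finrank_bot] at hdpos
      exact lt_irrefl 0 hdpos
    have hμ : ‖μ‖ ≤ 2 * s := hD μ (Module.End.hasEigenvalue_iff.mpr hne)
    have hre : |μ.re| ≤ 2 * s := (Complex.abs_re_le_norm μ).trans hμ
    simp only [hx_def, hy_def]
    rw [abs_div, abs_of_pos hs0, div_le_iff₀ hs0]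
    exact hre
  -- (2) the interval count from the Chebyshev moments
  have hEM0 : 0 ≤ EM := by rw [hEM_def]; positivity
  have ha : -2 ≤ α / s := by rw [le_div_iff₀ hs0]; linarith
  have hb : β / s ≤ 2 := by rw [div_le_iff₀ hs0]; linarith
  have hab : α / s ≤ β / s := div_le_div_of_nonneg_right hαβ hs0.le
  have hmom' : ∀ c : ℕ, c ≤ M →
      |∑ i : ι, (Polynomial.Chebyshev.U ℝ c).eval (x i / 2) -
        Fintype.card ι * (if Even c then (Real.sqrt (p : ℝ))⁻¹ ^ c else 0)| ≤ EM := by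
    intro c hc
    have h := hmom c (by omega)
    rw [← hsumι c] at h
    rw [hcardι]
    have hg : (if Even c then (Real.sqrt (p : ℝ))⁻¹ ^ c else 0) = γ c := by
      simp only [hγ_def, hq_def, hs_def]
    rw [hg]
    exact h
  have hB2 := abs_card_Icc_sub_integral_le x hx2 (p := (p : ℝ)) hp2 (M := M) hEM0 hmom' ha hab hb
  rw [hcardι] at hB2
  -- (3) the count of the statement is the count of the family
  have hgen : ∀ z, T.maxGenEigenspace z = T.eigenspace z := fun z ↦
    maxGenEigenspace_eq_eigenspace_of_selfAdjoint
      (fun x y ↦ peterssonProduct (Gamma0 N) 2 x y)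
      (fun u v w ↦ peterssonProduct_add_right 2 u v w)
      (fun c v w ↦ peterssonProduct_smul_right (Gamma0 N) 2 c v w)
      (fun v w ↦ peterssonProduct_conj_symm_holds (Gamma0 N) 2 v w)
      (fun v hv ↦ eq_zero_of_peterssonProduct_self_eq_zero 2 v hv)
      T (fun v w ↦ heckeT_selfAdjoint_holds N 2 p hp hpN v w) z
  have hcount : (∑ᶠ μ : ℝ, (Set.Icc α β).indicator (fun μ =>
      (Module.finrank ℂ (Module.End.maxGenEigenspace T (μ : ℂ)) : ℝ)) μ) =
      ((Finset.univ.filter fun i : ι => x i ∈ Set.Icc (α / s) (β / s)).card : ℝ) := by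
    have hcount0 : (∑ᶠ μ : ℝ, (Set.Icc α β).indicator (fun μ =>
        (Module.finrank ℂ (Module.End.maxGenEigenspace T (μ : ℂ)) : ℝ)) μ) =
        ∑ᶠ μ : ℝ, (Set.Icc α β).indicator (fun μ =>
          (Module.finrank ℂ (Module.End.eigenspace T (μ : ℂ)) : ℝ)) μ := by
      congr 1
      funext μ
      congr 1
      funext ν
      rw [hgen]
    rw [hcount0]
    -- finsum over the reals = sum over the real parts of `E`
    have hinj : Set.InjOn ((↑) : ℝ → ℂ) (((↑) : ℝ → ℂ) ⁻¹' (E : Set ℂ)) :=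
      Complex.ofReal_injective.injOn
    set S : Finset ℝ := E.preimage ((↑) : ℝ → ℂ) hinj with hS
    have hsupp : Function.support (fun μ : ℝ => (Set.Icc α β).indicator
        (fun μ => (Module.finrank ℂ (Module.End.eigenspace T (μ : ℂ)) : ℝ)) μ) ⊆ (S : Set ℝ) := by
      intro μ hμ
      rw [Function.mem_support] at hμ
      rw [hS, Finset.coe_preimage, Set.mem_preimage, Finset.mem_coe]
      by_contra hE
      apply hμ
      rw [Set.indicator_apply_eq_zero]
      intro _
      have := hbot _ hE
      change (d (μ : ℂ) : ℝ) = 0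
      simp only [hd_def]
      rw [this, finrank_bot, Nat.cast_zero]
    rw [finsum_eq_sum_of_support_subset _ hsupp]
    have hpre := Finset.sum_preimage ((↑) : ℝ → ℂ) E hinj
      (fun μ : ℂ => if μ.re ∈ Set.Icc α β then (d μ : ℝ) else 0) (by
        intro μ hμ hrange
        exfalso
        exact hrange ⟨μ.re, hre μ hμ⟩)
    have e1 : ∀ ν ∈ S, (Set.Icc α β).indicator
        (fun μ : ℝ => (Module.finrank ℂ (Module.End.eigenspace T (μ : ℂ)) : ℝ)) ν =
        (fun μ : ℂ => if μ.re ∈ Set.Icc α β then (d μ : ℝ) else 0) (ν : ℂ) := by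
      intro ν _
      first
        | rfl
        | simp [Set.indicator_apply, hd_def]
    rw [Finset.sum_congr rfl e1, hpre]
    -- the family count
    have hfam : ((Finset.univ.filter fun i : ι => x i ∈ Set.Icc (α / s) (β / s)).card : ℝ) =
        ∑ i : ι, if x i ∈ Set.Icc (α / s) (β / s) then (1 : ℝ) else 0 := by
      rw [Finset.sum_boole]
    rw [hfam, ← Finset.sum_coe_sort E, ← Finset.univ_sigma_univ, Finset.sum_sigma]
    refine Finset.sum_congr rfl fun μ _ ↦ ?_
    have hiff : y (μ : ℂ) ∈ Set.Icc (α / s) (β / s) ↔ (μ : ℂ).re ∈ Set.Icc α β := by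
      simp only [hy_def, Set.mem_Icc]
      rw [div_le_div_iff_of_pos_right hs0, div_le_div_iff_of_pos_right hs0]
    simp only [hx_def, Finset.sum_const, Finset.card_univ, Fintype.card_fin, nsmul_eq_mul]
    split_ifs with h1 h2 h2
    · ring
    · exact absurd (hiff.mpr h1) h2
    · exact absurd (hiff.mp h2) h1
    · ring
  -- (4) the integral of the statement is the integral of `2 g_p` over the angles
  have hαmem : α ∈ Set.Icc (-(2 * Real.sqrt p)) (2 * Real.sqrt p) := ⟨hα, by linarith⟩
  have hβmem : β ∈ Set.Icc (-(2 * Real.sqrt p)) (2 * Real.sqrt p) := ⟨by linarith, hβ⟩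
  have hp1' : (1 : ℝ) < p := by linarith
  have hint : ∫ t in α..β, serreDensity p t =
      ∫ θ in Real.arccos (β / s / 2)..Real.arccos (α / s / 2), 2 * kmDensity p θ := by
    rw [integral_serreDensity_eq hp1' hαmem hβmem, div_div, div_div, mul_comm s 2]
  refine ⟨?_, hdimψ, ?_, ?_⟩
  · rw [hcount, hint]
    calc _ ≤ 288 * (r : ℝ) / (M + 1) + 3 * (M + 1) * EM := hB2
      _ = _ := by rw [hEM_def]; ring
  · rw [hcount, ← hcardι]
    exact_mod_cast Finset.card_filter_le _ _
  · rw [hint]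
    have h1 : -1 ≤ β / s / 2 ∧ β / s / 2 ≤ 1 := by
      rw [div_div, le_div_iff₀ (by positivity), div_le_iff₀ (by positivity)]; constructor <;> linarith
    have h2 : -1 ≤ α / s / 2 ∧ α / s / 2 ≤ 1 := by
      rw [div_div, le_div_iff₀ (by positivity), div_le_iff₀ (by positivity)]; constructor <;> linarith
    exact integral_two_mul_kmDensity_mem hp1' (Real.arccos_nonneg _)
      (Real.arccos_le_arccos (by rw [div_div, div_div]; exact div_le_div_of_nonneg_right hαβ (by positivity)))
      (Real.arccos_le_pi _)

set_option maxHeartbeats 400000 in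
/-- **Cor. 23 / §10 bookkeeping, real-valued** (the statement of `multiplicity_bookkeeping` with a
real quantity `m ≤ r` in place of a multiplicity; proof verbatim): from `m ≤ 74 r/(M+1) + 58896
(M+1) p^{12M} (B+1)` for all `M`, `|r - ψ/12| ≤ 7361(B+1)`, `ψ ≥ N`, `B ≤ 81 N^{5/6}` and `m ≤ r`
one gets `m ≤ A r log p / log 2N` with an explicit absolute `A` (Murty–Sinha §10, p. 701: `M = [c
log kN / log p]`). [cite: MurtySinha2009, §10 p. 701 (choice of M)] -/
theorem real_bookkeeping (N p r : ℕ) (m : ℝ) (hN : N ≠ 0) (hp : 2 ≤ p) (B ψ : ℝ)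
    (hmr : m ≤ r)
    (hB : 0 ≤ B) (hBle : B ≤ 81 * (N : ℝ) ^ ((5 : ℝ) / 6)) (hψ : (N : ℝ) ≤ ψ)
    (hdim : abs ((r : ℝ) - ψ / 12) ≤ 7361 * (B + 1))
    (hcore : ∀ M : ℕ, m ≤ 74 * (r : ℝ) / (M + 1) +
      58896 * (M + 1) * (p : ℝ) ^ (12 * M) * (B + 1)) :
    m ≤ (7401 + (75 / 2 * Real.log (101 * (58896 * 82) * 4800 / Real.log 2) +
        (Real.log 2 + 6 * Real.log (24 * 7361 * 82))) / Real.log 2) * r * Real.log p /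
      Real.log (2 * N) := by
  -- the constants
  set K₀ : ℝ := 58896 * 82 with hK₀
  set K₁ : ℝ := 101 * K₀ * 4800 / Real.log 2 with hK₁
  set K₂ : ℝ := 24 * 7361 * 82 with hK₂
  have hlog2 : (0.6931471803 : ℝ) < Real.log 2 := Real.log_two_gt_d9
  have hlog2' : 0 < Real.log 2 := by linarith
  have hlog2ne : Real.log 2 ≠ 0 := hlog2'.ne'
  have hK₁pos : 1 < K₁ := by
    rw [hK₁, hK₀, lt_div_iff₀ hlog2']
    have h := Real.log_two_lt_d9
    linarith
  have hK₂pos : 1 < K₂ := by rw [hK₂]; norm_num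
  set L₀ : ℝ := 75 / 2 * Real.log K₁ + (Real.log 2 + 6 * Real.log K₂) with hL₀
  have hlogK₁ : 0 < Real.log K₁ := Real.log_pos hK₁pos
  have hlogK₂ : 0 < Real.log K₂ := Real.log_pos hK₂pos
  have hL₀pos : 0 < L₀ := by positivity
  show m ≤ (7401 + L₀ / Real.log 2) * r * Real.log p / Real.log (2 * N)
  -- basic quantities
  have hNpos : (0 : ℝ) < N := Nat.cast_pos.mpr (Nat.pos_of_ne_zero hN)
  have hN1 : (1 : ℝ) ≤ N := by exact_mod_cast Nat.one_le_iff_ne_zero.mpr hN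
  have h2N1 : (1 : ℝ) ≤ 2 * N := by linarith
  have h2N0 : (0 : ℝ) < 2 * N := by linarith
  have hp2 : (2 : ℝ) ≤ p := by exact_mod_cast hp
  set L : ℝ := Real.log (2 * N) with hL_def
  set ℓ : ℝ := Real.log p with hℓ_def
  have hℓ2 : Real.log 2 ≤ ℓ := Real.log_le_log (by norm_num) hp2
  have hℓ0 : 0 < ℓ := lt_of_lt_of_le hlog2' hℓ2
  have hℓne : ℓ ≠ 0 := hℓ0.ne'
  have hL2 : Real.log 2 ≤ L := Real.log_le_log (by norm_num) (by linarith)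
  have hL0 : 0 < L := lt_of_lt_of_le hlog2' hL2
  have hLne : L ≠ 0 := hL0.ne'
  have hr0 : (0 : ℝ) ≤ r := by positivity
  have hmr' : m ≤ r := hmr
  have hgoal_of : ∀ C : ℝ, C ≤ 7401 + L₀ / Real.log 2 → m ≤ C * r * ℓ / L →
      m ≤ (7401 + L₀ / Real.log 2) * r * ℓ / L := by
    intro C hC h
    refine h.trans ?_
    rw [div_le_div_iff_of_pos_right hL0]
    exact mul_le_mul_of_nonneg_right (mul_le_mul_of_nonneg_right hC hr0) hℓ0.le
  have hB1 : B + 1 ≤ 82 * (N : ℝ) ^ ((5 : ℝ) / 6) := by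
    have h2 : (1 : ℝ) ≤ (N : ℝ) ^ ((5 : ℝ) / 6) := Real.one_le_rpow hN1 (by norm_num)
    linarith
  have hLle : L ≤ 100 * (2 * (N : ℝ)) ^ ((1 : ℝ) / 100) := by
    have h1 : L ≤ (2 * (N : ℝ)) ^ ((1 : ℝ) / 100) / ((1 : ℝ) / 100) :=
      Real.log_le_rpow_div h2N0.le (by norm_num)
    rw [div_div_eq_mul_div, div_one] at h1
    linarith
  -- dichotomy: good levels versus small levels
  by_cases hgood : K₁ ≤ (2 * (N : ℝ)) ^ ((2 : ℝ) / 75) ∧ K₂ ≤ (N : ℝ) ^ ((1 : ℝ) / 6)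
  · obtain ⟨hG1, hG2⟩ := hgood
    -- Theorem 22 with `M = ⌊L / (100 ℓ)⌋`
    set M : ℕ := ⌊L / (100 * ℓ)⌋₊ with hM_def
    have hMle : (M : ℝ) ≤ L / (100 * ℓ) := Nat.floor_le (by positivity)
    have hMlt : L / (100 * ℓ) < M + 1 := Nat.lt_floor_add_one _
    have hM0 : (0 : ℝ) < M + 1 := by positivity
    have hmain := hcore M
    -- (i) main term `74 r/(M+1) ≤ 7400 r ℓ / L`
    have hi : 74 * (r : ℝ) / (M + 1) ≤ 7400 * r * ℓ / L := by
      rw [div_le_div_iff₀ hM0 hL0]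
      have h : L ≤ 100 * ℓ * (M + 1) := by
        rw [div_lt_iff₀ (by positivity)] at hMlt
        linarith
      nlinarith [mul_le_mul_of_nonneg_left h (by positivity : (0 : ℝ) ≤ 74 * r)]
    -- (ii) `p^{12M} ≤ (2N)^{3/25}`
    have hii : (p : ℝ) ^ (12 * M) ≤ (2 * (N : ℝ)) ^ ((3 : ℝ) / 25) := by
      have hp0 : (0 : ℝ) < p := by linarith
      rw [← Real.rpow_natCast, Real.rpow_def_of_pos hp0, Real.rpow_def_of_pos h2N0,
        Real.exp_le_exp, ← hℓ_def, ← hL_def]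
      push_cast
      have : ℓ * (12 * (M : ℝ)) ≤ ℓ * (12 * (L / (100 * ℓ))) :=
        mul_le_mul_of_nonneg_left (mul_le_mul_of_nonneg_left hMle (by norm_num)) hℓ0.le
      refine this.trans (le_of_eq ?_)
      field_simp
      ring
    -- (iii) `M + 1 ≤ 1 + L ≤ 101 (2N)^{1/100}`
    have hiii : (M : ℝ) + 1 ≤ 101 * (2 * (N : ℝ)) ^ ((1 : ℝ) / 100) := by
      have h100 : L / (100 * ℓ) ≤ L := by
        rw [div_le_iff₀ (by positivity)]
        have h1 : (1 : ℝ) ≤ 100 * ℓ := by linarith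
        nlinarith [mul_le_mul_of_nonneg_left h1 hL0.le]
      have h2 : (1 : ℝ) ≤ (2 * (N : ℝ)) ^ ((1 : ℝ) / 100) := Real.one_le_rpow h2N1 (by norm_num)
      linarith
    -- (iv) the error term is at most `101 K₀ (2N)^{289/300}`
    have hNle : (N : ℝ) ^ ((5 : ℝ) / 6) ≤ (2 * (N : ℝ)) ^ ((5 : ℝ) / 6) :=
      Real.rpow_le_rpow (by positivity) (by linarith) (by norm_num)
    have herr : 58896 * ((M : ℝ) + 1) * (p : ℝ) ^ (12 * M) * (B + 1) ≤
        101 * K₀ * (2 * (N : ℝ)) ^ ((289 : ℝ) / 300) := by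
      have hsplit : (2 * (N : ℝ)) ^ ((289 : ℝ) / 300) =
          (2 * (N : ℝ)) ^ ((1 : ℝ) / 100) * ((2 * (N : ℝ)) ^ ((3 : ℝ) / 25) *
            (2 * (N : ℝ)) ^ ((5 : ℝ) / 6)) := by
        rw [← Real.rpow_add h2N0, ← Real.rpow_add h2N0]
        norm_num
      rw [hsplit, hK₀]
      have hpM0 : 0 ≤ (p : ℝ) ^ (12 * M) := by positivity
      calc 58896 * ((M : ℝ) + 1) * (p : ℝ) ^ (12 * M) * (B + 1)
          ≤ 58896 * (101 * (2 * (N : ℝ)) ^ ((1 : ℝ) / 100)) * (2 * (N : ℝ)) ^ ((3 : ℝ) / 25) *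
              (82 * (2 * (N : ℝ)) ^ ((5 : ℝ) / 6)) := by
            refine mul_le_mul (mul_le_mul (mul_le_mul_of_nonneg_left hiii (by norm_num))
              hii hpM0 (by positivity)) (hB1.trans ?_) (by positivity) (by positivity)
            exact mul_le_mul_of_nonneg_left hNle (by norm_num)
        _ = 101 * (58896 * 82) * ((2 * (N : ℝ)) ^ ((1 : ℝ) / 100) *
              ((2 * (N : ℝ)) ^ ((3 : ℝ) / 25) * (2 * (N : ℝ)) ^ ((5 : ℝ) / 6))) := by ring
    -- (v) `r ≥ 2N/48` from `|r - ψ/12| ≤ 7361 (B+1)`, `ψ ≥ N`, `N^{1/6} ≥ K₂`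
    have hrN : (2 * (N : ℝ)) / 48 ≤ r := by
      have h56 : 7361 * (B + 1) ≤ (N : ℝ) / 24 := by
        have hN56 : (N : ℝ) = (N : ℝ) ^ ((1 : ℝ) / 6) * (N : ℝ) ^ ((5 : ℝ) / 6) := by
          rw [← Real.rpow_add hNpos]
          norm_num
        have h0 : 0 ≤ (N : ℝ) ^ ((5 : ℝ) / 6) := by positivity
        calc 7361 * (B + 1) ≤ 7361 * (82 * (N : ℝ) ^ ((5 : ℝ) / 6)) :=
              mul_le_mul_of_nonneg_left hB1 (by norm_num)
          _ = (K₂ * (N : ℝ) ^ ((5 : ℝ) / 6)) / 24 := by rw [hK₂]; ring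
          _ ≤ ((N : ℝ) ^ ((1 : ℝ) / 6) * (N : ℝ) ^ ((5 : ℝ) / 6)) / 24 :=
              div_le_div_of_nonneg_right (mul_le_mul_of_nonneg_right hG2 h0) (by norm_num)
          _ = (N : ℝ) / 24 := by rw [← hN56]
      have habs := abs_sub_le_iff.mp hdim
      linarith [habs.2]
    -- (vi) error ≤ r ℓ / L
    have hvii : 101 * K₀ * (2 * (N : ℝ)) ^ ((289 : ℝ) / 300) ≤ (r : ℝ) * ℓ / L := by
      have hx1 : 0 < (2 * (N : ℝ)) ^ ((1 : ℝ) / 100) := by positivity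
      have hlow : (2 * (N : ℝ)) / 48 * Real.log 2 / (100 * (2 * (N : ℝ)) ^ ((1 : ℝ) / 100)) ≤
          (r : ℝ) * ℓ / L := by
        rw [div_le_div_iff₀ (by positivity) hL0]
        have := mul_le_mul (mul_le_mul hrN hℓ2 hlog2'.le hr0) hLle hL0.le (by positivity)
        linarith [this]
      refine le_trans ?_ hlow
      rw [le_div_iff₀ (by positivity)]
      have h2N : (2 * (N : ℝ)) = (2 * (N : ℝ)) ^ ((2 : ℝ) / 75) *
          ((2 * (N : ℝ)) ^ ((289 : ℝ) / 300) * (2 * (N : ℝ)) ^ ((1 : ℝ) / 100)) := by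
        rw [← Real.rpow_add h2N0, ← Real.rpow_add h2N0]
        norm_num
      have hx2 : 0 ≤ (2 * (N : ℝ)) ^ ((289 : ℝ) / 300) * (2 * (N : ℝ)) ^ ((1 : ℝ) / 100) := by
        positivity
      have hK₁' : 101 * K₀ * 4800 / Real.log 2 ≤ (2 * (N : ℝ)) ^ ((2 : ℝ) / 75) := by
        rw [← hK₁]; exact hG1
      calc 101 * K₀ * (2 * (N : ℝ)) ^ ((289 : ℝ) / 300) * (100 * (2 * (N : ℝ)) ^ ((1 : ℝ) / 100))
          = (101 * K₀ * 4800 / Real.log 2) *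
              ((2 * (N : ℝ)) ^ ((289 : ℝ) / 300) * (2 * (N : ℝ)) ^ ((1 : ℝ) / 100)) *
                (Real.log 2 / 48) := by
            field_simp
            ring
        _ ≤ (2 * (N : ℝ)) ^ ((2 : ℝ) / 75) *
              ((2 * (N : ℝ)) ^ ((289 : ℝ) / 300) * (2 * (N : ℝ)) ^ ((1 : ℝ) / 100)) *
                (Real.log 2 / 48) :=
            mul_le_mul_of_nonneg_right (mul_le_mul_of_nonneg_right hK₁' hx2)
              (div_nonneg hlog2'.le (by norm_num))
        _ = 2 * (N : ℝ) / 48 * Real.log 2 := by rw [← h2N]; ring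
    -- conclude in the good regime with constant `7401`
    refine hgoal_of 7401 (by linarith [div_nonneg hL₀pos.le hlog2'.le]) ?_
    calc m ≤ 74 * (r : ℝ) / (M + 1) + 58896 * (M + 1) * (p : ℝ) ^ (12 * M) * (B + 1) := hmain
      _ ≤ 7400 * r * ℓ / L + r * ℓ / L := add_le_add hi (herr.trans hvii)
      _ = 7401 * r * ℓ / L := by ring
  · -- small levels: `L ≤ L₀`, and `m ≤ r ≤ (L₀ / log 2) · r ℓ / L`
    have hLle₀ : L ≤ L₀ := by
      rw [not_and_or, not_le, not_le] at hgood
      rcases hgood with h1 | h2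
      · -- `(2N)^{2/75} < K₁`
        have hpos : 0 < (2 * (N : ℝ)) ^ ((2 : ℝ) / 75) := by positivity
        have hlog : Real.log ((2 * (N : ℝ)) ^ ((2 : ℝ) / 75)) < Real.log K₁ :=
          Real.log_lt_log hpos h1
        rw [Real.log_rpow h2N0, ← hL_def] at hlog
        have hL' : L < 75 / 2 * Real.log K₁ := by
          have h := mul_lt_mul_of_pos_left hlog (show (0 : ℝ) < 75 / 2 by norm_num)
          calc L = 75 / 2 * (2 / 75 * L) := by ring
            _ < 75 / 2 * Real.log K₁ := h
        rw [hL₀]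
        exact (hL'.trans_le (le_add_of_nonneg_right
          (add_nonneg hlog2'.le (mul_nonneg (by norm_num) hlogK₂.le)))).le
      · -- `N^{1/6} < K₂`
        have hpos : 0 < (N : ℝ) ^ ((1 : ℝ) / 6) := by positivity
        have hlog : Real.log ((N : ℝ) ^ ((1 : ℝ) / 6)) < Real.log K₂ := Real.log_lt_log hpos h2
        rw [Real.log_rpow hNpos] at hlog
        have hLN : L = Real.log 2 + Real.log N := by
          rw [hL_def, Real.log_mul (by norm_num) (Nat.cast_ne_zero.mpr hN)]
        have hN' : Real.log N < 6 * Real.log K₂ := by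
          have h := mul_lt_mul_of_pos_left hlog (show (0 : ℝ) < 6 by norm_num)
          calc Real.log N = 6 * (1 / 6 * Real.log N) := by ring
            _ < 6 * Real.log K₂ := h
        rw [hL₀, hLN]
        calc Real.log 2 + Real.log N ≤ Real.log 2 + 6 * Real.log K₂ := by
              exact add_le_add le_rfl hN'.le
          _ ≤ 75 / 2 * Real.log K₁ + (Real.log 2 + 6 * Real.log K₂) :=
              le_add_of_nonneg_left (mul_nonneg (by norm_num) hlogK₁.le)
    refine hgoal_of (L₀ / Real.log 2) (by linarith) ?_
    have hkey : (r : ℝ) ≤ L₀ / Real.log 2 * r * ℓ / L := by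
      rw [le_div_iff₀ hL0]
      have h1 : (r : ℝ) * L * Real.log 2 ≤ r * L₀ * Real.log 2 :=
        mul_le_mul_of_nonneg_right (mul_le_mul_of_nonneg_left hLle₀ hr0) hlog2'.le
      have h2 : (r : ℝ) * L₀ * Real.log 2 ≤ r * L₀ * ℓ :=
        mul_le_mul_of_nonneg_left hℓ2 (by positivity)
      have h3 : L₀ / Real.log 2 * r * ℓ = (r * L₀ * ℓ) / Real.log 2 := by ring
      rw [h3, le_div_iff₀ hlog2']
      exact h1.trans h2
    exact hmr'.trans hkey

end MurtySinha

open Literature.NumberTheory.Automorphic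
  Literature.NumberTheory.Automorphic.HeckeTraceFormulaGL2Level in
/-- **Murty–Sinha 2009, Theorem 2 (weight `2`), from the trace identities at prime powers and
Deligne's bound.** If for every level `N ≥ 1` and prime `p ∤ N` the Eichler–Selberg identity
`Tr(T_{p^c} | S₂(Γ₀(N))) = A₁ + A₂ + A₃ + A₄` (Schoof–van der Vlugt Thm. 2.2 = Murty–Sinha Thm. 10,
weight `2`, trivial character, `n = p^c`) holds for all `c ≥ 0`, and every eigenvalue of `T_p` on
`S₂(Γ₀(N))` has absolute value `≤ 2√p` (Deligne, loc. cit. §1), then the named fact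
`murtySinha2009_thm2_weightTwo` holds, with the absolute constant `A = (288/37)·A₂₃`, `A₂₃` the
constant of `multiplicity_bookkeeping` (`MurtySinha.count_sub_integral_le_of_primePowTraces` +
`MurtySinha.real_bookkeeping` applied to `(37/288)·|count - r∫dμ_p| ≤ r`). [cite: MurtySinha2009,
Thm. 2 p. 682 and §10 p. 701] -/
theorem murtySinha2009_thm2_weightTwo_of_primePowTraces
    (hTF : ∀ (N : ℕ) [NeZero N] (p : ℕ) [NeZero p], p.Prime → ¬ p ∣ N →
      ∀ c : ℕ, cuspidalHeckeTrace N 2 1 (p ^ c) = geometricSide N 1 2 (p ^ c))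
    (hD : ∀ (N : ℕ) [NeZero N] (ℓ : ℕ) [NeZero ℓ], ℓ.Prime → ¬ ℓ ∣ N → ∀ μ : ℂ,
      Module.End.HasEigenvalue (heckeT (Gamma0 N) 2 ℓ) μ → ‖μ‖ ≤ 2 * Real.sqrt ℓ) :
    murtySinha2009_thm2_weightTwo := by
  unfold murtySinha2009_thm2_weightTwo
  refine ⟨288 / 37 * (7401 + (75 / 2 * Real.log (101 * (58896 * 82) * 4800 / Real.log 2) +
      (Real.log 2 + 6 * Real.log (24 * 7361 * 82))) / Real.log 2), ?_⟩
  intro N _ p _ hp hpN α β hα hαβ hβ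
  have hN0 : N ≠ 0 := NeZero.ne N
  set r : ℕ := Module.finrank ℂ (CuspForm (Gamma0 N) 2) with hr
  set Q : ℝ := |(∑ᶠ μ : ℝ, (Set.Icc α β).indicator (fun μ =>
      (Module.finrank ℂ (Module.End.maxGenEigenspace (heckeT (Gamma0 N) 2 p) (μ : ℂ)) : ℝ)) μ) -
      (r : ℝ) * ∫ t in α..β, ((p : ℝ) + 1) * Real.sqrt (4 * p - t ^ 2) /
        (2 * Real.pi * (((p : ℝ) + 1) ^ 2 - t ^ 2))| with hQ
  have hres := fun M : ℕ ↦ MurtySinha.count_sub_integral_le_of_primePowTraces N p hp hpN (hTF N p hp hpN)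
    (hD N p hp hpN) hα hαβ hβ M
  have hser : (fun t : ℝ => ((p : ℝ) + 1) * Real.sqrt (4 * p - t ^ 2) /
      (2 * Real.pi * (((p : ℝ) + 1) ^ 2 - t ^ 2))) = MurtySinha.serreDensity (p : ℝ) := by
    funext t; rfl
  have hQ' : Q = |(∑ᶠ μ : ℝ, (Set.Icc α β).indicator (fun μ =>
      (Module.finrank ℂ (Module.End.maxGenEigenspace (heckeT (Gamma0 N) 2 p) (μ : ℂ)) : ℝ)) μ) -
      (r : ℝ) * ∫ t in α..β, MurtySinha.serreDensity p t| := by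
    rw [hQ, ← hser]
  -- the core bound for all `M`, rescaled by `37/288`
  set m : ℝ := 37 / 288 * Q with hm
  have hB : (0 : ℝ) ≤ ∑ c ∈ N.divisors, (Nat.gcd c (N / c) : ℝ) :=
    Finset.sum_nonneg fun _ _ ↦ by positivity
  have hp2 : (2 : ℝ) ≤ p := by exact_mod_cast hp.two_le
  have hcore : ∀ M : ℕ, m ≤ 74 * (r : ℝ) / (M + 1) +
      58896 * (M + 1) * (p : ℝ) ^ (12 * M) * (∑ c ∈ N.divisors, (Nat.gcd c (N / c) : ℝ) + 1) := by
    intro M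
    have h := (hres M).1
    rw [← hQ'] at h
    have hM : (0 : ℝ) < M + 1 := by positivity
    have hX : 0 ≤ (M + 1) * (p : ℝ) ^ (12 * M) * (∑ c ∈ N.divisors, (Nat.gcd c (N / c) : ℝ) + 1) := by
      positivity
    rw [hm]
    have hY : 0 ≤ (r : ℝ) / (M + 1) := by positivity
    have e1 : 288 * (Module.finrank ℂ (CuspForm (Gamma0 N) 2) : ℝ) / (M + 1) =
        288 * ((r : ℝ) / (M + 1)) := by rw [hr]; ring
    have e2 : 74 * (r : ℝ) / (M + 1) = 74 * ((r : ℝ) / (M + 1)) := by ring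
    rw [e1] at h
    rw [e2]
    linarith
  have hdim := (hres 0).2.1
  -- the trivial bound `Q ≤ 2r`, hence `m ≤ r`
  have hmr : m ≤ r := by
    have h3 := (hres 0).2.2.1
    have h4 := (hres 0).2.2.2
    have hr0 : (0 : ℝ) ≤ r := by positivity
    have hcnt0 : 0 ≤ ∑ᶠ μ : ℝ, (Set.Icc α β).indicator (fun μ =>
        (Module.finrank ℂ (Module.End.maxGenEigenspace (heckeT (Gamma0 N) 2 p) (μ : ℂ)) : ℝ)) μ :=
      finsum_nonneg fun μ ↦ Set.indicator_nonneg (fun _ _ ↦ by positivity) _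
    have hQle : Q ≤ 2 * r := by
      rw [hQ', abs_le]
      constructor <;> nlinarith [h4.1, h4.2, h3, hcnt0]
    rw [hm]
    linarith
  have hBle := MurtySinha.sum_divisors_gcd_le_rpow N hN0
  have hψ : (N : ℝ) ≤ (dedekindPsi N : ℝ) := by exact_mod_cast MurtySinha.le_dedekindPsi N
  have hbk := MurtySinha.real_bookkeeping N p r m hN0 hp.two_le _ _ hmr hB hBle hψ hdim hcore
  rw [hm] at hbk
  have hfin : Q ≤ 288 / 37 * ((7401 + (75 / 2 * Real.log (101 * (58896 * 82) * 4800 / Real.log 2) +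
      (Real.log 2 + 6 * Real.log (24 * 7361 * 82))) / Real.log 2) * r * Real.log p /
      Real.log (2 * N)) := by
    linarith
  rw [hQ] at hfin
  convert hfin using 1
  ring

open Literature.NumberTheory.Automorphic
  Literature.NumberTheory.Automorphic.HeckeTraceFormulaGL2Level in
/-- **Murty–Sinha 2009, Theorem 2 (weight `2`), from the Eichler–Selberg trace formula and
Deligne's bound.** If the trace formula `HeckeTraceFormulaGL2Level N 1 2` (Schoof–van der Vlugt
Thm. 2.2 = Murty–Sinha Thm. 10) holds at every level `N` and Deligne's bound
`Deligne1974_heckeT_eigenvalue_norm_le` holds, then `murtySinha2009_thm2_weightTwo` holds — exactly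
the two external inputs of the printed proof ('The main ingredients in the proof of Theorem 2 are
the Theorem 8, the Eichler–Selberg trace formula and certain trigonometric polynomials', p. 684,
Theorem 8 being proved in `Literature.Analysis.Fourier.ErdosTuranDiscrepancy`; Deligne's theorem
enters in §1, p. 681). [cite: MurtySinha2009, Thm. 2 p. 682] -/
theorem murtySinha2009_thm2_weightTwo_of_traceFormula
    (hTF : ∀ (N : ℕ) [NeZero N], HeckeTraceFormulaGL2Level N 1 2)
    (hD : Deligne1974_heckeT_eigenvalue_norm_le) :
    murtySinha2009_thm2_weightTwo :=
  murtySinha2009_thm2_weightTwo_of_primePowTraces (fun N _ _ _ hp _ c ↦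
    MurtySinha.traceFormula_two_one (hTF N) (pow_pos hp.pos c)) hD.weight_two

end Literature.NumberTheory.EllipticCurves.ModularForms

end
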